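import Summits.BirchSwinnertonDyer.BirchSwinnertonDyer.Theorems.GenusKolyvaginAtTwoMinimalTwinBSDTwoSwappedPairLocalBit
import HarnessLib

/-!
# Route `GenusKolyvaginAtTwo`, crux U₂ `MinimalTwinBSDTwo` (stmt-BirchSwinnertonDyer-22985), LINE 23 «twin_swap» v2.5, stub NDIV′
# `HeegnerIndexLowerAnyTwinAtTwo`: ON A Ш-TRIVIAL ODD FRAME THE LOWER HALF IS THE EGG BIT OF THE HEEGNER POINT

Width seat `bsd-line-gk2-p5` g45 (cell `bsd-f1-sign2`), `--supports stmt-BirchSwinnertonDyer-22985` (helper; closes nothing).  THEOREMS ONLY (no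
definition, no named fact, no `sorry`); standard axioms.  **BSD is NOT proved by this file; U₂ / NDIV′ / DIV′ are NOT proved; nothing is closed.**

CONTEXT.  LINE 23 v2.5 (gk2-p2 g29, `Cruxes/MinimalTwinBSDTwo/Lines/twin_swap.lean`) splits KEX′ into DIV′ ∧ NDIV′; the lower half NDIV′ asks, at every
odd Heegner frame with `2` split and every exact `2`-depth `M₀` of `P(1)` in `W(K[1])`, for
`2^(2M₀) ∣ #Ш(W_K)[2^∞] · 2^(2(ord₂ c + ord₂ C(W)))`.  This file is the kernel side of the seat's memo
`Cruxes/MinimalTwinBSDTwo/ARCH-COMPONENT-ROAD-gk2p5-g45.md` (the archimedean component road): on the frames where the right-hand side is ODD —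
`Ш(W_K)[2^∞]` trivial, Manin constant odd, Tamagawa product odd (the hTw0-egg cell of the route's `closes`) — the NDIV′ conclusion at the exact depth
is EQUIVALENT to «`P(1) ∉ 2W(K[1])`», and on gk2-p4 g26's all-silent `Δ > 0` frame (`…SwappedPairLocalBit.not_two_dvd_derivedPoint_iff_localBit_posDisc`)
to «the rational Heegner point `Y` is NOT halvable in `E(ℝ)`», i.e. to the cell's EGG BIT `b(E,K) = 1` (-data AN13); the memo identifies that bit with an
oval bit of `X₀⁺(N)(ℝ)`.  Conversely, at ANY frame, `P(1) ∉ 2W(K[1])` gives the NDIV′ conclusion outright (the exact depth is then `0`).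

* §1 (pure algebra) existence of the exact `2`-depth (re-derived, route-free imports), `exactTwoDepth_eq_zero_of_not_two_zsmul`, `not_two_zsmul_of_two_pow_dvd_odd`.
* §2 (any frame) `heegnerIndexLower_conclusion_of_not_two_zsmul` — NDIV′'s conclusion at every exact depth from `P(1) ∉ 2W(K[1])`;
  `not_two_zsmul_derivedPoint_of_heegnerIndexLower_conclusion` — the converse on a Ш-trivial odd frame;
  `heegnerIndexLower_conclusion_iff_not_two_zsmul` — the equivalence there (the exact depth exists: `P(1)` of infinite order, `W(K[1])` finitely generated).
* §3 (the all-silent `Δ > 0` frame) `heegnerIndexLower_conclusion_iff_eggBit` — NDIV′'s conclusion at every exact depth ⟺ `Y ∉ 2E(ℝ)`.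

References: [GrossLMS1991] §5 Prop. 5.3; [McCallumLMS1991] §5 Lemma 5.1; [MazurRubin2010] Lemma 2.9, Cor. 3.4 (i); [Kramer1981] Prop. 6;
[GrossZagier1986] V.§2 (2.2).
-/

set_option autoImplicit false
set_option linter.dupNamespace false -- `Summit.<P>.<Sub>` repeats `BirchSwinnertonDyer` (D-0017)

noncomputable section

open scoped Classical NumberField

namespace Summit.BirchSwinnertonDyer.BirchSwinnertonDyer.Theorems.GenusExact.TwinSwap.ArchRoad

open IsDedekindDomain Field NumberField WeierstrassCurve Literature.NumberTheory.EllipticCurves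
  Literature.NumberTheory.EllipticCurves.ModularForms
open Summit.BirchSwinnertonDyer.BirchSwinnertonDyer.Theorems.GenusExact.TwinSwapBit
  (not_two_dvd_derivedPoint_iff_localBit_posDisc)

/-! ## §1 Pure algebra: exact `2`-depth (existence re-derived here to keep the import cone route-free) and depth zero -/

/-- A point of infinite order in a finitely generated abelian group is not divisible by every power of `2` (Gross 1991 §2: `E(K)` is finitely
generated, so `y_K` is not infinitely divisible): a non-zero coordinate `c` of `ȳ ∈ A/A_tors` has `2^M ∤ c` once `2^M > |c|`.  (Same proof as
`KolyvaginAtTwo.exists_not_two_pow_zsmul_eq`, repeated to avoid importing a route cone.) [cite: GrossLMS1991, §2 (paragraph before Prop. 2.1)] -/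
private theorem exists_not_two_pow_zsmul_eq' {A : Type*} [AddCommGroup A] [Module.Finite ℤ A] {y : A}
    (hy : ¬ IsOfFinAddOrder y) : ∃ M : ℕ, 1 ≤ M ∧ ¬ ∃ Q : A, ((2 ^ M : ℕ) : ℤ) • Q = y := by
  set T := AddCommGroup.torsion A with hT_def
  let π : A →ₗ[ℤ] A ⧸ T := (QuotientAddGroup.mk' T).toIntLinearMap
  have hπ : Function.Surjective π := QuotientAddGroup.mk'_surjective T
  haveI : Module.Finite ℤ (A ⧸ T) := Module.Finite.of_surjective π hπ
  haveI : NoZeroSMulDivisors ℤ (A ⧸ T) := inferInstance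
  haveI : Module.Free ℤ (A ⧸ T) := Module.free_of_finite_type_torsion_free'
  have hy' : π y ≠ 0 := by
    intro h
    apply hy
    have hmem : y ∈ T := (QuotientAddGroup.eq_zero_iff y).mp h
    exact hmem
  let b := Module.Free.chooseBasis ℤ (A ⧸ T)
  obtain ⟨i, hi⟩ : ∃ i, b.repr (π y) i ≠ 0 := by
    by_contra h
    push Not at h
    exact hy' (b.repr.injective (Finsupp.ext fun i ↦ by simpa using h i))
  obtain ⟨k, hk⟩ : ∃ k : ℕ, k = (b.repr (π y) i).natAbs + 1 := ⟨_, rfl⟩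
  refine ⟨k, by omega, ?_⟩
  rintro ⟨Q, hQ⟩
  have hdvd : ((2 ^ k : ℕ) : ℤ) ∣ b.repr (π y) i := by
    refine ⟨b.repr (π Q) i, ?_⟩
    have h1 : π y = ((2 ^ k : ℕ) : ℤ) • π Q := by
      rw [← hQ, map_zsmul]
    rw [h1, map_zsmul, Finsupp.smul_apply, smul_eq_mul]
  have hdvd' : 2 ^ k ∣ (b.repr (π y) i).natAbs := by
    have := Int.natAbs_dvd_natAbs.mpr hdvd
    simpa using this
  have hle : 2 ^ k ≤ (b.repr (π y) i).natAbs := Nat.le_of_dvd (Int.natAbs_pos.mpr hi) hdvd'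
  have hlt : (b.repr (π y) i).natAbs < 2 ^ k :=
    hk ▸ (Nat.lt_two_pow_self).trans (Nat.pow_lt_pow_right (by norm_num) (Nat.lt_succ_self _))
  omega

/-- **Exact `2`-divisibility depth of a point of infinite order** in a finitely generated abelian group: some `u` with `2^u ∣ y` and `2^(u+1) ∤ y`
(McCallum 1991 §5: `M₀ < ∞`).  (Same proof as `KolyvaginAtTwo.exists_exactTwoDepth`.) [cite: McCallumLMS1991, §5 Lemma 5.1] -/
private theorem exists_exactTwoDepth' {A : Type*} [AddCommGroup A] [Module.Finite ℤ A] {y : A} (hy : ¬ IsOfFinAddOrder y) :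
    ∃ u : ℕ, (∃ Q : A, ((2 ^ u : ℕ) : ℤ) • Q = y) ∧ ¬ ∃ Q : A, ((2 ^ (u + 1) : ℕ) : ℤ) • Q = y := by
  obtain ⟨M₀, -, hM₀⟩ := exists_not_two_pow_zsmul_eq' hy
  have hex : ∃ u : ℕ, ¬ ∃ Q : A, ((2 ^ u : ℕ) : ℤ) • Q = y := ⟨M₀, hM₀⟩
  have h0 : Nat.find hex ≠ 0 := by
    intro h
    have hspec := Nat.find_spec hex
    rw [h] at hspec
    exact hspec ⟨y, by simp⟩
  refine ⟨Nat.find hex - 1, ?_, ?_⟩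
  · have hlt : Nat.find hex - 1 < Nat.find hex := by omega
    have h := Nat.find_min hex hlt
    rwa [not_not] at h
  · rw [Nat.sub_add_cancel (Nat.one_le_iff_ne_zero.mpr h0)]
    exact Nat.find_spec hex

/-- If `y` has no half then any `2`-power divisibility `2^M ∣ y` has `M = 0`. [folklore] -/
theorem exactTwoDepth_eq_zero_of_not_two_zsmul {A : Type*} [AddCommGroup A] {y : A} {M : ℕ}
    (h2 : ¬ ∃ Q : A, (2 : ℤ) • Q = y) (hdiv : ∃ Q : A, ((2 ^ M : ℕ) : ℤ) • Q = y) : M = 0 := by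
  by_contra hM
  obtain ⟨Q, hQ⟩ := hdiv
  refine h2 ⟨((2 ^ (M - 1) : ℕ) : ℤ) • Q, ?_⟩
  rw [smul_smul, ← hQ]
  congr 1
  have hM1 : M = (M - 1) + 1 := by omega
  conv_rhs => rw [hM1, pow_succ]
  push_cast
  ring

/-- If `2^(2M)` divides an odd number then `M = 0`, so `2^(M+1) ∤ y` at `M` reads `2 ∤ y`. [folklore] -/
theorem not_two_zsmul_of_two_pow_dvd_odd {A : Type*} [AddCommGroup A] {y : A} {M m : ℕ} (hm : Odd m)
    (hdvd : 2 ^ (2 * M) ∣ m) (hndiv : ¬ ∃ Q : A, ((2 ^ (M + 1) : ℕ) : ℤ) • Q = y) : ¬ ∃ Q : A, (2 : ℤ) • Q = y := by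
  have hM : M = 0 := by
    by_contra hM
    have h2 : (2 : ℕ) ∣ m := (dvd_pow_self 2 (by omega : 2 * M ≠ 0)).trans hdvd
    exact (Nat.not_even_iff_odd.mpr hm) (even_iff_two_dvd.mpr h2)
  subst hM
  simpa using hndiv

/-! ## §2 NDIV′'s conclusion at a frame versus «`P(1) ∉ 2W(K[1])`» -/

variable (W : WeierstrassCurve ℚ) [W.IsElliptic] [W.IsGloballyMinimal] {K : Type} [Field K] [NumberField K]

omit [W.IsElliptic] [W.IsGloballyMinimal] in
/-- **NDIV′ at a frame from the depth-zero bit** (any frame, no hypothesis on `W`, `K`, `Ш`): if `P(1) ∉ 2W(K[1])` then every exact `2`-depth `M₀` of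
`P(1)` is `0`, so `2^(2M₀)` divides anything — in particular NDIV′'s right-hand side `#Ш(W_K)[2^∞] · 2^(2(ord₂ c + ord₂ C(W)))`. [folklore] -/
theorem heegnerIndexLower_conclusion_of_not_two_zsmul [NeZero (W.conductorNorm ℤ)]
    (Dt : ModularParametrizationData W (W.conductorNorm ℤ)) (β : ℤ) (ι : K →+* ℂ) (d₁ : KolyvaginHeegnerData Dt β ι 1)
    (h2 : ¬ ∃ Q : (W.baseChange (ringClassField K ι 1)).toAffine.Point, (2 : ℤ) • Q = d₁.derivedPoint) (M₀ : ℕ)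
    (hdiv : ∃ Q : (W.baseChange (ringClassField K ι 1)).toAffine.Point, ((2 ^ M₀ : ℕ) : ℤ) • Q = d₁.derivedPoint) :
    2 ^ (2 * M₀) ∣ Nat.card (AddCommGroup.primaryComponent (W.baseChange K).sha 2) *
      2 ^ (2 * (padicValInt 2 Dt.c + padicValNat 2 W.tamagawaProduct)) := by
  rw [exactTwoDepth_eq_zero_of_not_two_zsmul h2 hdiv]
  simp

omit [W.IsElliptic] [W.IsGloballyMinimal] in
/-- **The converse on a Ш-TRIVIAL ODD frame**: if `#Ш(W_K)[2^∞] = 1`, `ord₂ c = 0`, `ord₂ C(W) = 0`, then NDIV′'s conclusion at an exact depth `M₀`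
(`2^(2M₀) ∣ 1 · 2^0`) forces `M₀ = 0`, i.e. `P(1) ∉ 2W(K[1])`. [folklore] -/
theorem not_two_zsmul_derivedPoint_of_heegnerIndexLower_conclusion [NeZero (W.conductorNorm ℤ)]
    (Dt : ModularParametrizationData W (W.conductorNorm ℤ)) (β : ℤ) (ι : K →+* ℂ) (d₁ : KolyvaginHeegnerData Dt β ι 1)
    (hSha : Nat.card (AddCommGroup.primaryComponent (W.baseChange K).sha 2) = 1) (hc : padicValInt 2 Dt.c = 0)
    (hC : padicValNat 2 W.tamagawaProduct = 0) (M₀ : ℕ)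
    (hndiv : ¬ ∃ Q : (W.baseChange (ringClassField K ι 1)).toAffine.Point, ((2 ^ (M₀ + 1) : ℕ) : ℤ) • Q = d₁.derivedPoint)
    (hN : 2 ^ (2 * M₀) ∣ Nat.card (AddCommGroup.primaryComponent (W.baseChange K).sha 2) *
      2 ^ (2 * (padicValInt 2 Dt.c + padicValNat 2 W.tamagawaProduct))) :
    ¬ ∃ Q : (W.baseChange (ringClassField K ι 1)).toAffine.Point, (2 : ℤ) • Q = d₁.derivedPoint := by
  rw [hSha, hc, hC] at hN
  have hN' : 2 ^ (2 * M₀) ∣ 1 := by simpa only [one_mul, add_zero, mul_zero, pow_zero, mul_one] using hN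
  exact not_two_zsmul_of_two_pow_dvd_odd (m := 1) odd_one hN' hndiv

omit [W.IsGloballyMinimal] in
/-- **On a Ш-trivial odd frame, NDIV′ (at every exact depth) ⟺ `P(1) ∉ 2W(K[1])`.**  Frame: `K` imaginary quadratic, `P(1)` of infinite order (so an
exact `2`-depth EXISTS in the finitely generated `W(K[1])`, `exists_exactTwoDepth'`), `#Ш(W_K)[2^∞] = 1`, `ord₂ c = 0`, `ord₂ C(W) = 0`.
CONDITIONAL on those displayed hypotheses; closes nothing. [cite: McCallumLMS1991, §5 Lemma 5.1 (proof: «M₀ is finite»)] -/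
theorem heegnerIndexLower_conclusion_iff_not_two_zsmul [NeZero (W.conductorNorm ℤ)] (hK : IsImaginaryQuadratic K)
    (Dt : ModularParametrizationData W (W.conductorNorm ℤ)) (β : ℤ) (ι : K →+* ℂ) (d₁ : KolyvaginHeegnerData Dt β ι 1)
    (hy : ¬ IsOfFinAddOrder d₁.derivedPoint)
    (hSha : Nat.card (AddCommGroup.primaryComponent (W.baseChange K).sha 2) = 1) (hc : padicValInt 2 Dt.c = 0)
    (hC : padicValNat 2 W.tamagawaProduct = 0) :
    (∀ M₀ : ℕ, (∃ Q : (W.baseChange (ringClassField K ι 1)).toAffine.Point, ((2 ^ M₀ : ℕ) : ℤ) • Q = d₁.derivedPoint) →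
      (¬ ∃ Q : (W.baseChange (ringClassField K ι 1)).toAffine.Point, ((2 ^ (M₀ + 1) : ℕ) : ℤ) • Q = d₁.derivedPoint) →
        2 ^ (2 * M₀) ∣ Nat.card (AddCommGroup.primaryComponent (W.baseChange K).sha 2) *
          2 ^ (2 * (padicValInt 2 Dt.c + padicValNat 2 W.tamagawaProduct))) ↔
    ¬ ∃ Q : (W.baseChange (ringClassField K ι 1)).toAffine.Point, (2 : ℤ) • Q = d₁.derivedPoint := by
  refine ⟨fun h ↦ ?_, fun h2 M₀ hdiv _ ↦ heegnerIndexLower_conclusion_of_not_two_zsmul W Dt β ι d₁ h2 M₀ hdiv⟩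
  -- the exact depth exists: `P(1)` has infinite order in the finitely generated `W(K[1])`
  haveI := (finiteDimensional_and_isGalois_ringClassField hK ι one_ne_zero).1
  haveI : NumberField (ringClassField K ι 1) := NumberField.of_module_finite K _
  haveI : (W.baseChange (ringClassField K ι 1)).IsElliptic := by rw [baseChange]; infer_instance
  haveI : Module.Finite ℤ (W.baseChange (ringClassField K ι 1)).toAffine.Point := by
    convert (W.baseChange (ringClassField K ι 1)).module_finite_point_holds
  obtain ⟨M₀, hdiv, hndiv⟩ := exists_exactTwoDepth'
    (A := (W.baseChange (ringClassField K ι 1)).toAffine.Point) (y := d₁.derivedPoint) (by convert hy)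
  exact not_two_zsmul_derivedPoint_of_heegnerIndexLower_conclusion W Dt β ι d₁ hSha hc hC M₀ hndiv (h M₀ hdiv hndiv)

/-! ## §3 The all-silent `Δ > 0` frame: NDIV′ ⟺ the egg bit -/

/-- ★ **NDIV′ on the Ш-trivial all-silent `Δ > 0` frame IS the egg bit of the rational Heegner point.**  Frame (gk2-p4 g26's hTw0 frame + Ш-triviality):
`W/ℚ` with `r_an = 1`, `#Sel₂(E) = 2`, `C(E)` odd; `K` imaginary quadratic with odd `d_K`, Heegner for `N_E`; a datum `Dt` with `c` odd, `(β, ι)`, a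
conductor-`1` datum `d₁` with `P(1)` of infinite order; an elliptic `Wd ≅ E^(d_K)` with `#Sel₂(Wd) = 1` and `ord₂ C(Wd) = 0` (all primes of `d_K` silent);
`#Ш(W_K)[2^∞] = 1`.  THEN `Δ_E > 0` and there are `P₀ ∈ E(K)` over `P(1)`, a RATIONAL `Y ∈ E(ℚ)` and a torsion `u` with `ι Y = P₀ + 2u` such that
**«NDIV′'s conclusion holds at every exact depth of `P(1)`» ⟺ «`Y ∉ 2E(ℝ)`» (the Heegner point is on the egg)**.  By the seat's memo that bit is the
oval bit of `X₀⁺(N)(ℝ)` at the `w_N`-real CM point of `K`.  CONDITIONAL; closes nothing.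
[cite: GrossLMS1991, §5 Prop. 5.3] [cite: McCallumLMS1991, §5 Lemma 5.1] [cite: MazurRubin2010, Lemma 2.9, Cor. 3.4 (i)] [cite: Kramer1981, Prop. 6] -/
theorem heegnerIndexLower_conclusion_iff_eggBit [NeZero (W.conductorNorm ℤ)]
    (hr : W.analyticRank = 1) (hSel : Nat.card (W.selmerGroup 2) = 2) (hTam : Odd W.tamagawaProduct)
    (hK : IsImaginaryQuadratic K) (hodd : Odd (NumberField.discr K)) (hH : SatisfiesHeegnerHypothesis (W.conductorNorm ℤ) K)
    (Dt : ModularParametrizationData W (W.conductorNorm ℤ)) (hc : padicValInt 2 Dt.c = 0) (β : ℤ) (ι : K →+* ℂ)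
    (d₁ : KolyvaginHeegnerData Dt β ι 1) (hy : ¬ IsOfFinAddOrder d₁.derivedPoint)
    (Wd : WeierstrassCurve ℚ) [Wd.IsElliptic] (hWd : ∃ C : VariableChange ℚ, C • W.quadraticTwist (NumberField.discr K : ℚ) = Wd)
    (hSel1 : Nat.card (Wd.selmerGroup 2) = 1) (hDEF : padicValNat 2 Wd.tamagawaProduct = 0)
    (hSha : Nat.card (AddCommGroup.primaryComponent (W.baseChange K).sha 2) = 1) :
    0 < W.Δ ∧
      ∃ (P₀ : (W.baseChange K).toAffine.Point) (Y : W.toAffine.Point) (u : (W.baseChange K).toAffine.Point),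
        Affine.Point.map (W' := W) (algebraMap K (ringClassField K ι 1)).toRatAlgHom P₀ = d₁.derivedPoint ∧
        IsOfFinAddOrder u ∧ QuadraticDescent.incl K W Y = P₀ + (2 : ℤ) • u ∧
        ((∀ M₀ : ℕ, (∃ Q : (W.baseChange (ringClassField K ι 1)).toAffine.Point, ((2 ^ M₀ : ℕ) : ℤ) • Q = d₁.derivedPoint) →
            (¬ ∃ Q : (W.baseChange (ringClassField K ι 1)).toAffine.Point, ((2 ^ (M₀ + 1) : ℕ) : ℤ) • Q = d₁.derivedPoint) →
              2 ^ (2 * M₀) ∣ Nat.card (AddCommGroup.primaryComponent (W.baseChange K).sha 2) *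
                2 ^ (2 * (padicValInt 2 Dt.c + padicValNat 2 W.tamagawaProduct))) ↔
          ¬ ∃ R : (W.baseChange (Place.Completion (Sum.inl Rat.infinitePlace : Place ℚ))).toAffine.Point,
            ((2 : ℕ) : ℤ) • R = Affine.Point.baseChange (W' := W) ℚ (Place.Completion (Sum.inl Rat.infinitePlace : Place ℚ)) Y) := by
  have hC : padicValNat 2 W.tamagawaProduct = 0 := padicValNat.eq_zero_of_not_dvd (Odd.not_two_dvd_nat hTam)
  obtain ⟨hpos, P₀, Y, u, hP₀, hu, hY, hbit⟩ :=
    not_two_dvd_derivedPoint_iff_localBit_posDisc W hr hSel hTam hK hodd hH Dt β ι d₁ hy Wd hWd hSel1 hDEF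
  refine ⟨hpos, P₀, Y, u, hP₀, hu, hY, ?_⟩
  rw [heegnerIndexLower_conclusion_iff_not_two_zsmul W hK Dt β ι d₁ hy hSha hc hC]
  exact hbit

end Summit.BirchSwinnertonDyer.BirchSwinnertonDyer.Theorems.GenusExact.TwinSwap.ArchRoad

end
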